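import Summits.Parity.GeneralizedHardyLittlewood.Theorems.LeeYangFibresCellParityLawP2Defs
import Summits.Parity.GeneralizedHardyLittlewood.Theorems.LeeYangFibresCellParityLawModelPrimeSumIntegerSum
import Summits.Parity.GeneralizedHardyLittlewood.Theorems.LeeYangFibresCellParityLawPrimeUpperBound
import HarnessLib

/-!
# Route `LeeYangFibres`, crux `CellParityLaw` (stmt-Parity-14109), line `section-annihilator`:
# tools for the induction `KernelInduction` (skeleton v18) — error currency and vanishing cells

Skeleton v18 (lead c5). Elementary bookkeeping used by the proof of `stub_kernelInduction`
(`PrimeUpperBound → RecursionIdentity → FibreInheritance → ModelPrimeSum → EffectiveWeightedP2Law →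
EffectiveRoughCellLawStrong`):

* the algebra of the error currency `kernelErr C κ A₂ 𝒜 x z η Λ R
  = C(η^κ + (log z)^{-κ} + log(2Λ)/log z) V(z)A(x) + C (log x)^{A₂}(R + x/z)` — linear in `C`, antitone in `κ`
  (for `η ≤ 1 ≤ log z`), monotone in `A₂` (for `1 ≤ log x`), and the conversions of the raw error shapes
  `R`, `x/z`, `V A/log z`, `V A η` into it (`KernelErrAux`);
* vanishing of rough cells with too many prime factors: `P⁻(q)^{Ω(q)} ≤ q`, so `C_m(𝒜; x, z) = 0` once
  `z^m ≥ x`, and the fibre cells `C_n(𝒜_p; x/p, p − 1/2)` vanish once `p^{n+1} > x` (`VanishAux`);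
* the telescoping bound `Σ_{z < p ≤ P} g(p) V(p) ≤ V(z)` and the junk sum `Σ_{z<p} x/(p(p − 1/2)) ≤ 4x/z`
  (`PrimeSumAux`).

References: E. Bombieri, RIMS Kôkyûroku 294 (1977) [BombieriRIMS1977]; H. L. Montgomery, R. C. Vaughan,
*Multiplicative Number Theory I*, §7.2 [MontgomeryVaughan2007].
-/

noncomputable section

open scoped BigOperators Classical
open Finset Literature.NumberTheory.Sieve

namespace Summit.Parity.GeneralizedHardyLittlewood.Cruxes.CellParityLaw.SectionAnnihilator

/-! ## The error currency -/

namespace KernelErrAux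

/-- `kernelErr` is linear in its constant: `kernelErr C + kernelErr C' = kernelErr (C + C')`. -/
theorem kernelErr_add (C C' κ : ℝ) (A₂ : ℕ) (𝒜 : SieveSequence) (x z η Λ R : ℝ) :
    kernelErr C κ A₂ 𝒜 x z η Λ R + kernelErr C' κ A₂ 𝒜 x z η Λ R = kernelErr (C + C') κ A₂ 𝒜 x z η Λ R := by
  unfold kernelErr; ring

/-- `s · kernelErr C = kernelErr (s C)`. -/
theorem kernelErr_smul (s C κ : ℝ) (A₂ : ℕ) (𝒜 : SieveSequence) (x z η Λ R : ℝ) :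
    s * kernelErr C κ A₂ 𝒜 x z η Λ R = kernelErr (s * C) κ A₂ 𝒜 x z η Λ R := by
  unfold kernelErr; ring

/-- The relative bracket `η^κ + (log z)^{-κ} + log(2Λ)/log z` is nonnegative (`η ≥ 0`, `Λ ≥ 1/2`, `log z > 0`). -/
theorem bracket_nonneg {κ η Λ z : ℝ} (hη : 0 ≤ η) (hΛ : 1 / 2 ≤ Λ) (hz : 1 < z) :
    0 ≤ η ^ κ + Real.log z ^ (-κ) + Real.log (2 * Λ) / Real.log z := by
  have hlz : 0 < Real.log z := Real.log_pos hz
  have h1 : 0 ≤ η ^ κ := Real.rpow_nonneg hη κ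
  have h2 : 0 ≤ Real.log z ^ (-κ) := Real.rpow_nonneg hlz.le _
  have h3 : 0 ≤ Real.log (2 * Λ) := Real.log_nonneg (by linarith)
  positivity

/-- `kernelErr C … ≥ 0` for `C ≥ 0` and nonnegative data. -/
theorem kernelErr_nonneg {C κ : ℝ} {A₂ : ℕ} {𝒜 : SieveSequence} {x z η Λ R : ℝ} (hC : 0 ≤ C)
    (hη : 0 ≤ η) (hΛ : 1 / 2 ≤ Λ) (hz : 1 < z) (hx : 1 ≤ x) (hV : 0 ≤ 𝒜.densityProduct (primesProdBelow z))
    (hA : 0 ≤ 𝒜.size x) (hR : 0 ≤ R) : 0 ≤ kernelErr C κ A₂ 𝒜 x z η Λ R := by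
  unfold kernelErr
  have hb := bracket_nonneg (κ := κ) hη hΛ hz
  have hlx : 0 ≤ Real.log x := Real.log_nonneg hx
  have hz0 : 0 < z := by linarith
  positivity

/-- **Monotonicity of the currency**: `C ≤ C'`, `0 < κ' ≤ κ`, `A₂ ≤ A₂'`, with `0 ≤ η ≤ 1`, `e ≤ z` (so
`log z ≥ 1`), `e ≤ x`, give `kernelErr C κ A₂ ≤ kernelErr C' κ' A₂'`. -/
theorem kernelErr_mono {C C' κ κ' : ℝ} {A₂ A₂' : ℕ} {𝒜 : SieveSequence} {x z η Λ R : ℝ}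
    (hC : 0 ≤ C) (hCC' : C ≤ C') (hκ' : 0 < κ') (hκκ' : κ' ≤ κ) (hA : A₂ ≤ A₂')
    (hη0 : 0 ≤ η) (hη1 : η ≤ 1) (hΛ : 1 / 2 ≤ Λ) (hz : Real.exp 1 ≤ z) (hx : Real.exp 1 ≤ x)
    (hV : 0 ≤ 𝒜.densityProduct (primesProdBelow z)) (hAs : 0 ≤ 𝒜.size x) (hR : 0 ≤ R) :
    kernelErr C κ A₂ 𝒜 x z η Λ R ≤ kernelErr C' κ' A₂' 𝒜 x z η Λ R := by
  have he1 : 1 < Real.exp 1 := Real.one_lt_exp_iff.mpr one_pos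
  have hz1 : 1 < z := he1.trans_le hz
  have hx1 : 1 ≤ x := he1.le.trans hx
  have hz0 : 0 < z := by linarith
  have hx0 : 0 < x := by linarith
  have hlz : 1 ≤ Real.log z := by rw [Real.le_log_iff_exp_le hz0]; exact hz
  have hlx : 1 ≤ Real.log x := by rw [Real.le_log_iff_exp_le hx0]; exact hx
  have hlz0 : 0 < Real.log z := by linarith
  -- the bracket is antitone in `κ`
  have hb : η ^ κ + Real.log z ^ (-κ) + Real.log (2 * Λ) / Real.log z ≤
      η ^ κ' + Real.log z ^ (-κ') + Real.log (2 * Λ) / Real.log z := by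
    have h1 : η ^ κ ≤ η ^ κ' := by
      rcases eq_or_lt_of_le hη0 with h | h
      · rw [← h, Real.zero_rpow (by linarith), Real.zero_rpow hκ'.ne']
      · exact Real.rpow_le_rpow_of_exponent_ge h hη1 hκκ'
    have h2 : Real.log z ^ (-κ) ≤ Real.log z ^ (-κ') :=
      Real.rpow_le_rpow_of_exponent_le hlz (by linarith)
    linarith
  have hb0 := bracket_nonneg (κ := κ) hη0 hΛ hz1
  have hpow : Real.log x ^ A₂ ≤ Real.log x ^ A₂' := pow_le_pow_right₀ hlx hA
  unfold kernelErr
  have hVA : 0 ≤ 𝒜.densityProduct (primesProdBelow z) * 𝒜.size x := mul_nonneg hV hAs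
  have hRz : 0 ≤ R + x / z := by positivity
  have hC' : 0 ≤ C' := hC.trans hCC'
  calc C * (η ^ κ + Real.log z ^ (-κ) + Real.log (2 * Λ) / Real.log z) *
          (𝒜.densityProduct (primesProdBelow z) * 𝒜.size x) + C * Real.log x ^ A₂ * (R + x / z)
      ≤ C' * (η ^ κ' + Real.log z ^ (-κ') + Real.log (2 * Λ) / Real.log z) *
          (𝒜.densityProduct (primesProdBelow z) * 𝒜.size x) + C' * Real.log x ^ A₂' * (R + x / z) := by
        gcongr

/-- The sum of two currencies with possibly different exponents is a currency:
`kernelErr C κ A₂ + kernelErr C' κ' A₂' ≤ kernelErr (C + C') (min κ κ') (max A₂ A₂')`. -/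
theorem kernelErr_add_le {C C' κ κ' : ℝ} {A₂ A₂' : ℕ} {𝒜 : SieveSequence} {x z η Λ R : ℝ}
    (hC : 0 ≤ C) (hC' : 0 ≤ C') (hκ : 0 < κ) (hκ' : 0 < κ')
    (hη0 : 0 ≤ η) (hη1 : η ≤ 1) (hΛ : 1 / 2 ≤ Λ) (hz : Real.exp 1 ≤ z) (hx : Real.exp 1 ≤ x)
    (hV : 0 ≤ 𝒜.densityProduct (primesProdBelow z)) (hAs : 0 ≤ 𝒜.size x) (hR : 0 ≤ R) :
    kernelErr C κ A₂ 𝒜 x z η Λ R + kernelErr C' κ' A₂' 𝒜 x z η Λ R ≤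
      kernelErr (C + C') (min κ κ') (max A₂ A₂') 𝒜 x z η Λ R := by
  rw [← kernelErr_add]
  exact add_le_add
    (kernelErr_mono hC le_rfl (lt_min hκ hκ') (min_le_left _ _) (le_max_left _ _) hη0 hη1 hΛ hz hx hV hAs hR)
    (kernelErr_mono hC' le_rfl (lt_min hκ hκ') (min_le_right _ _) (le_max_right _ _) hη0 hη1 hΛ hz hx hV hAs hR)

/-- **Raw errors into the currency.** For `0 ≤ η ≤ 1`, `e ≤ z`, `e ≤ x`, `Λ ≥ 1/2`, `0 < κ ≤ 1` and nonnegative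
`V, A, R`: the four raw shapes `V A η`, `V A / log z`, `V A log(2Λ)/log z` and `R + x/z` are each bounded by
`kernelErr 1 κ 0`. -/
theorem raw_le_kernelErr {κ : ℝ} {𝒜 : SieveSequence} {x z η Λ R : ℝ} (hκ : 0 < κ) (hκ1 : κ ≤ 1)
    (hη0 : 0 ≤ η) (hη1 : η ≤ 1) (hΛ : 1 / 2 ≤ Λ) (hz : Real.exp 1 ≤ z) (hx : Real.exp 1 ≤ x)
    (hV : 0 ≤ 𝒜.densityProduct (primesProdBelow z)) (hAs : 0 ≤ 𝒜.size x) (hR : 0 ≤ R) :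
    (𝒜.densityProduct (primesProdBelow z) * 𝒜.size x) * η ≤ kernelErr 1 κ 0 𝒜 x z η Λ R ∧
    (𝒜.densityProduct (primesProdBelow z) * 𝒜.size x) * (Real.log z)⁻¹ ≤ kernelErr 1 κ 0 𝒜 x z η Λ R ∧
    (𝒜.densityProduct (primesProdBelow z) * 𝒜.size x) * (Real.log (2 * Λ) / Real.log z) ≤
      kernelErr 1 κ 0 𝒜 x z η Λ R ∧
    R + x / z ≤ kernelErr 1 κ 0 𝒜 x z η Λ R := by
  have he1 : 1 < Real.exp 1 := Real.one_lt_exp_iff.mpr one_pos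
  have hz1 : 1 < z := he1.trans_le hz
  have hz0 : 0 < z := by linarith
  have hx0 : 0 < x := by linarith
  have hlz : 1 ≤ Real.log z := by rw [Real.le_log_iff_exp_le hz0]; exact hz
  have hlz0 : 0 < Real.log z := by linarith
  set VA := 𝒜.densityProduct (primesProdBelow z) * 𝒜.size x with hVA
  have hVA0 : 0 ≤ VA := mul_nonneg hV hAs
  have h1 : 0 ≤ η ^ κ := Real.rpow_nonneg hη0 κ
  have h2 : 0 ≤ Real.log z ^ (-κ) := Real.rpow_nonneg hlz0.le _
  have h3 : 0 ≤ Real.log (2 * Λ) / Real.log z := div_nonneg (Real.log_nonneg (by linarith)) hlz0.le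
  have hRz : 0 ≤ R + x / z := by positivity
  have hE : kernelErr 1 κ 0 𝒜 x z η Λ R =
      (η ^ κ + Real.log z ^ (-κ) + Real.log (2 * Λ) / Real.log z) * VA + (R + x / z) := by
    unfold kernelErr; rw [hVA]; ring
  -- `η ≤ η^κ` and `(log z)⁻¹ ≤ (log z)^{-κ}`
  have hηκ : η ≤ η ^ κ := by
    rcases eq_or_lt_of_le hη0 with h | h
    · rw [← h, Real.zero_rpow hκ.ne']
    · calc η = η ^ (1 : ℝ) := (Real.rpow_one η).symm
        _ ≤ η ^ κ := Real.rpow_le_rpow_of_exponent_ge h hη1 hκ1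
  have hlκ : (Real.log z)⁻¹ ≤ Real.log z ^ (-κ) := by
    rw [← Real.rpow_neg_one]
    exact Real.rpow_le_rpow_of_exponent_le hlz (by linarith)
  refine ⟨?_, ?_, ?_, ?_⟩
  · rw [hE]; nlinarith [mul_le_mul_of_nonneg_left hηκ hVA0]
  · rw [hE]; nlinarith [mul_le_mul_of_nonneg_left hlκ hVA0]
  · rw [hE]; nlinarith
  · rw [hE]; nlinarith

end KernelErrAux

/-! ## Vanishing of cells with too many prime factors -/

namespace VanishAux

/-- `P⁻(q)^{Ω(q)} ≤ q` for `q ≥ 1`: every prime factor (with multiplicity) is at least the least one. [folklore] -/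
theorem minFac_pow_cardFactors_le : ∀ q : ℕ, 1 ≤ q → q.minFac ^ ArithmeticFunction.cardFactors q ≤ q := by
  intro q
  induction q using Nat.strong_induction_on with
  | _ q ih =>
    intro hq
    rcases eq_or_lt_of_le hq with h1 | h2
    · subst h1; simp [ArithmeticFunction.cardFactors_one]
    · have hq1 : q ≠ 1 := by omega
      have hp : q.minFac.Prime := Nat.minFac_prime hq1
      obtain ⟨m, hm⟩ := Nat.minFac_dvd q
      have hm0 : m ≠ 0 := by rintro rfl; simp at hm; omega
      have hm1 : 1 ≤ m := Nat.pos_of_ne_zero hm0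
      have hmq : m < q := by
        rw [hm]; exact lt_mul_of_one_lt_left (by omega) hp.one_lt
      have hΩ : ArithmeticFunction.cardFactors q = ArithmeticFunction.cardFactors m + 1 := by
        conv_lhs => rw [hm]
        rw [ArithmeticFunction.cardFactors_mul hp.ne_zero hm0, ArithmeticFunction.cardFactors_apply_prime hp]
        ring
      -- `P⁻(q) ≤ P⁻(m)` unless `m = 1`
      rcases eq_or_ne m 1 with hm1' | hm1'
      · subst hm1'
        rw [hΩ, ArithmeticFunction.cardFactors_one]
        simp only [zero_add, pow_one]
        exact Nat.minFac_le (by omega)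
      · have hmin : q.minFac ≤ m.minFac := by
          rcases Nat.le_minFac.mpr (fun r hr hrm =>
            Nat.minFac_le_of_dvd hr.two_le (hrm.trans (Dvd.intro_left _ hm.symm))) with h | h
          · exact absurd h hm1'
          · exact h
        have hq' : m * q.minFac = q := by rw [mul_comm]; exact hm.symm
        calc q.minFac ^ ArithmeticFunction.cardFactors q
            = q.minFac ^ ArithmeticFunction.cardFactors m * q.minFac := by rw [hΩ, pow_succ]
          _ ≤ m.minFac ^ ArithmeticFunction.cardFactors m * q.minFac := by
              gcongr
          _ ≤ m * q.minFac := by gcongr; exact ih m hmq hm1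
          _ = q := hq'

/-- **Cells with too many factors are empty**: if `0 < z` and `x ≤ z^m` then `C_m(𝒜; x, z) = 0` (a `z`-rough
`q` with `Ω(q) = m` exceeds `z^m ≥ x`). -/
theorem roughCellSum_eq_zero_of_pow_le (𝒜 : SieveSequence) {x z : ℝ} {m : ℕ} (hz : 0 < z)
    (hxz : x < z ^ m) : roughCellSum 𝒜 x z m = 0 := by
  unfold roughCellSum
  refine Finset.sum_eq_zero fun q hq => ?_
  exfalso
  simp only [Finset.mem_filter, Finset.mem_Ioc] at hq
  obtain ⟨⟨hq0, hqx⟩, hzq, hΩ⟩ := hq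
  have hx0 : (1 : ℝ) ≤ x := Nat.floor_pos.mp (by omega)
  have hqx' : (q : ℝ) ≤ x := (Nat.le_floor_iff (by linarith)).mp hqx
  have hpow := minFac_pow_cardFactors_le q hq0
  rw [hΩ] at hpow
  have hpow' : ((q.minFac : ℝ)) ^ m ≤ (q : ℝ) := by exact_mod_cast hpow
  have hzm : z ^ m ≤ (q.minFac : ℝ) ^ m := pow_le_pow_left₀ hz.le hzq.le m
  linarith

/-- **The fibre cells vanish above `x^{1/(n+1)}`**: for a prime `p` with `x < p^{n+1}` (and `p ≥ 1`),
`C_n(𝒜_p; x/p, p − 1/2) = 0` (an element `m` has `Ω(m) = n` prime factors `≥ p`, so `m ≥ p^n > x/p`). -/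
theorem fibre_roughCellSum_eq_zero (𝒜 : SieveSequence) {x : ℝ} {p n : ℕ} (hp : 1 ≤ p)
    (hx : x < (p : ℝ) ^ (n + 1)) : roughCellSum (fibreSeq 𝒜 p) (x / p) ((p : ℝ) - 1 / 2) n = 0 := by
  unfold roughCellSum
  refine Finset.sum_eq_zero fun m hm => ?_
  exfalso
  simp only [Finset.mem_filter, Finset.mem_Ioc] at hm
  obtain ⟨⟨hm0, hmx⟩, hpm, hΩ⟩ := hm
  have hp0 : (0 : ℝ) < p := by exact_mod_cast hp
  have hmx' : (m : ℝ) ≤ x / p := (Nat.le_floor_iff' (by omega)).mp hmx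
  have hpow := minFac_pow_cardFactors_le m hm0
  rw [hΩ] at hpow
  -- `p ≤ P⁻(m)` from `p − 1/2 < P⁻(m)`
  have hple : p ≤ m.minFac := by
    by_contra hlt
    push Not at hlt
    have : (m.minFac : ℝ) + 1 ≤ (p : ℝ) := by exact_mod_cast hlt
    linarith
  have h1 : (p : ℝ) ^ n ≤ (m : ℝ) := by
    calc (p : ℝ) ^ n ≤ (m.minFac : ℝ) ^ n := pow_le_pow_left₀ hp0.le (by exact_mod_cast hple) n
      _ ≤ (m : ℝ) := by exact_mod_cast hpow
  have h2 : (m : ℝ) * p ≤ x := by rwa [le_div_iff₀ hp0] at hmx'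
  have h3 : (p : ℝ) ^ (n + 1) ≤ x := by
    calc (p : ℝ) ^ (n + 1) = (p : ℝ) ^ n * p := pow_succ _ _
      _ ≤ (m : ℝ) * p := by gcongr
      _ ≤ x := h2
  linarith

/-- **`stub_minFacPowCardFactors`** (registered auxiliary sub-goal of stmt-Parity-14109, tools of the induction
of skeleton v18): `P⁻(q)^{Ω(q)} ≤ q` for `q ≥ 1`. -/
theorem stub_minFacPowCardFactors :
    ∀ q : ℕ, 1 ≤ q → q.minFac ^ ArithmeticFunction.cardFactors q ≤ q :=
  minFac_pow_cardFactors_le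

end VanishAux

/-! ## Prime sums: telescoping and junk -/

namespace PrimeSumAux

open ModelPrimeSumAux in
/-- **Telescoping bound** `Σ_{z < p ≤ P, p prime} g(p) V(p) ≤ V(z)` (`0 ≤ g(p) < 1` at primes):
`g(p)V(p) = V(p) − V(p+1)` at primes and `V(n) − V(n+1) = 0` otherwise, so the sum telescopes to
`V(⌊z⌋+1) − V(P+1) ≤ V(⌊z⌋+1) ≤ V(z)`. -/
theorem sum_density_mul_densityProduct_le (𝒜 : SieveSequence)
    (hg : ∀ p : ℕ, p.Prime → 0 ≤ 𝒜.density p ∧ 𝒜.density p < 1) (z : ℝ) (P : ℕ) :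
    ∑ p ∈ (Finset.Ioc ⌊z⌋₊ P).filter Nat.Prime,
        𝒜.density p * 𝒜.densityProduct (primesProdBelow (p : ℝ)) ≤
      𝒜.densityProduct (primesProdBelow z) := by
  set V : ℕ → ℝ := fun n => 𝒜.densityProduct (primesProdBelow (n : ℝ)) with hV
  -- rewrite the prime sum as the integer sum of the telescoping differences
  have hstep : ∀ n : ℕ, (if n.Prime then 𝒜.density n * 𝒜.densityProduct (primesProdBelow (n : ℝ)) else 0) =
      V n - V (n + 1) := fun n => by
    rw [hV]; exact (densityProduct_natCast_sub_succ 𝒜 n).symm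
  rw [Finset.sum_filter]
  simp_rw [hstep]
  have hVz : V (⌊z⌋₊ + 1) ≤ 𝒜.densityProduct (primesProdBelow z) := by
    -- `V(⌊z⌋+1) = ∏_{q ≤ ⌊z⌋} (1-g q)` contains all factors of `V(z) = ∏_{q < ⌈z⌉}` and more, each in `[0,1]`
    have hzz : z ≤ ((⌊z⌋₊ + 1 : ℕ) : ℝ) := by push_cast; exact (Nat.lt_floor_add_one z).le
    rw [hV]
    dsimp only
    rw [PrimeUpperBoundAux.densityProduct_split 𝒜 hzz]
    refine mul_le_of_le_one_left (densityProduct_mem_Icc 𝒜 hg _).1 ?_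
    refine Finset.prod_le_one (fun p hp => ?_) fun p hp => ?_
    · have hpp := Nat.prime_of_mem_primesBelow (Finset.mem_filter.mp hp).1
      linarith [(hg p hpp).2]
    · have hpp := Nat.prime_of_mem_primesBelow (Finset.mem_filter.mp hp).1
      linarith [(hg p hpp).1]
  rcases le_or_gt ⌊z⌋₊ P with hle | hgt
  · rw [Literature.NumberTheory.LFunctions.RobinAnalytic.sum_Ioc_telescope V hle]
    linarith [(densityProduct_mem_Icc 𝒜 hg (primesProdBelow ((P + 1 : ℕ) : ℝ))).1]
  · rw [Finset.Ioc_eq_empty (by omega), Finset.sum_empty]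
    exact (densityProduct_mem_Icc 𝒜 hg _).1

/-- **The junk sum** `Σ_{z < p ≤ P} (x/p)/(p − 1/2) ≤ 4x/z` for `x ≥ 0`, `z ≥ 2` (each term is
`≤ 2x/(p(p−1)) = 2x(1/(p−1) − 1/p)`, telescoping from `⌊z⌋ ≥ z/2`). -/
theorem sum_div_mul_sub_half_le {x z : ℝ} (hx : 0 ≤ x) (hz : 2 ≤ z) (P : ℕ) :
    ∑ p ∈ (Finset.Ioc ⌊z⌋₊ P).filter Nat.Prime, x / p / ((p : ℝ) - 1 / 2) ≤ 4 * x / z := by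
  have hz1 : 1 ≤ ⌊z⌋₊ := Nat.le_floor (by norm_num; linarith)
  have hfl : z / 2 ≤ (⌊z⌋₊ : ℝ) := by
    have := Nat.lt_floor_add_one z
    have h1 : (1 : ℝ) ≤ ⌊z⌋₊ := by exact_mod_cast hz1
    linarith
  have hz0 : 0 < z := by linarith
  -- compare with the full integer sum of `2x (1/(n-1) − 1/n)` over `Ioc ⌊z⌋ P`
  calc ∑ p ∈ (Finset.Ioc ⌊z⌋₊ P).filter Nat.Prime, x / p / ((p : ℝ) - 1 / 2)
      ≤ ∑ n ∈ Finset.Ioc ⌊z⌋₊ P, x / n / ((n : ℝ) - 1 / 2) := by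
        refine Finset.sum_le_sum_of_subset_of_nonneg (Finset.filter_subset _ _) fun n hn _ => ?_
        have hn1 : ⌊z⌋₊ < n := (Finset.mem_Ioc.mp hn).1
        have hn2 : (2 : ℝ) ≤ n := by exact_mod_cast (show 2 ≤ n by omega)
        have : (0 : ℝ) < (n : ℝ) - 1 / 2 := by linarith
        positivity
    _ ≤ ∑ n ∈ Finset.Ioc ⌊z⌋₊ P, 2 * x * (1 / ((n : ℝ) - 1) - 1 / n) := by
        refine Finset.sum_le_sum fun n hn => ?_
        have hn1 : ⌊z⌋₊ < n := (Finset.mem_Ioc.mp hn).1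
        have hn2 : (2 : ℝ) ≤ n := by exact_mod_cast (show 2 ≤ n by omega)
        have hn0 : (0 : ℝ) < n := by linarith
        have hnm1 : (0 : ℝ) < (n : ℝ) - 1 := by linarith
        have hnh : (0 : ℝ) < (n : ℝ) - 1 / 2 := by linarith
        have e : 1 / ((n : ℝ) - 1) - 1 / n = 1 / (n * ((n : ℝ) - 1)) := by
          field_simp; ring
        rw [e, div_div, mul_one_div]
        exact div_le_div₀ (by positivity) (by linarith) (mul_pos hn0 hnm1) (by nlinarith)
    _ = 2 * x * ∑ n ∈ Finset.Ioc ⌊z⌋₊ P, (1 / ((n : ℝ) - 1) - 1 / n) := by rw [Finset.mul_sum]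
    _ ≤ 2 * x * (1 / ((⌊z⌋₊ : ℝ))) := by
        refine mul_le_mul_of_nonneg_left ?_ (by positivity)
        rcases le_or_gt ⌊z⌋₊ P with hle | hgt
        · have h := Literature.NumberTheory.LFunctions.RobinAnalytic.sum_Ioc_telescope
            (fun n : ℕ => 1 / ((n : ℝ) - 1)) hle
          have h' : ∑ n ∈ Finset.Ioc ⌊z⌋₊ P, (1 / ((n : ℝ) - 1) - 1 / n) =
              1 / ((⌊z⌋₊ : ℝ)) - 1 / (P : ℝ) := by
            have h2 := h
            simp only [Nat.cast_add, Nat.cast_one, add_sub_cancel_right] at h2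
            exact h2
          rw [h']
          have hP : (0 : ℝ) ≤ 1 / (P : ℝ) := by positivity
          linarith
        · rw [Finset.Ioc_eq_empty (by omega), Finset.sum_empty]
          positivity
    _ ≤ 4 * x / z := by
        have hfl0 : (0 : ℝ) < ⌊z⌋₊ := by exact_mod_cast hz1
        rw [mul_one_div, div_le_div_iff₀ hfl0 hz0]
        nlinarith

end PrimeSumAux

end Summit.Parity.GeneralizedHardyLittlewood.Cruxes.CellParityLaw.SectionAnnihilator

end
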